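import Summits.CriticalPhenomena.SAWScalingLimit.Theorems.SAWLeftRightFKGLeftRightFKGDefs
import Literature.Probability.RandomPlanarGeometry.FreelyJointedSAWCovariance
import HarnessLib

/-!
# Stub `stub_meshReduction` of line `corner-localisation`

Crux `LeftRightFKG` (stmt-CriticalPhenomena-11232), vocabulary module
`Summits.CriticalPhenomena.SAWScalingLimit.Theorems.SAWLeftRightFKGLeftRightFKGDefs`.

Everything in the crux scales with the mesh `δ > 0`:

* `meshPoint δ x = δ · meshPoint 1 x`, hence (polylines are equivariant under real-affine maps,
  `Polyline.polyline_map_apply`) `w.toCurve (meshPoint δ) = δ · w.toCurve (meshPoint 1)`;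
* `wind (c · g) = wind g` for a complex constant `c ≠ 0` (including the junk cases), hence
  `dom C δ = δ · dom C 1`, `meshVertices`, `meshGraph`, `meshDomain` and `discreteDomainGraph` of
  `(dom C δ, δ)` and `(dom C 1, 1)` coincide, and the left–right order `lr` is scale invariant;
* the chords of `(C, δ)` and `(C, 1)` are therefore in a support-preserving bijection
  (`SimpleGraph.Walk.transfer` along the equality of graphs) preserving `lr`.

This proves the registered signature `stub_meshReduction : MeshReduction`.
-/

noncomputable section

open Literature.Probability.LatticeModels Literature.Probability.RandomPlanarGeometry
open Literature.Topology.PlaneTopology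
open Complex Set

namespace Summit.CriticalPhenomena.SAWScalingLimit.Theorems.LeftRightFKG.CornerLoc

/-! ## Scaling of mesh points, polylines and curves -/

/-- `meshPoint δ = δ · meshPoint 1`. [folklore] -/
theorem meshPoint_eq_mul (δ : ℝ) (x : Site 2) : meshPoint δ x = (δ : ℂ) * meshPoint 1 x := by
  simp [meshPoint]

/-- Polylines through rescaled lattice points are rescaled polylines. [folklore] -/
theorem polyline_map_meshPoint (δ : ℝ) : ∀ (l : List (Site 2)) (t : unitInterval),
    polyline (l.map (meshPoint δ)) t = (δ : ℂ) * polyline (l.map (meshPoint 1)) t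
  | [], t => by simp
  | a :: l, t => by
    have hcomp : (meshPoint δ : Site 2 → ℂ) =
        (LinearMap.mulLeft ℝ (δ : ℂ)).toAffineMap ∘ (meshPoint 1 : Site 2 → ℂ) :=
      funext fun x => by simp [meshPoint]
    rw [hcomp, ← List.map_map]
    exact Polyline.polyline_map_apply (LinearMap.mulLeft ℝ (δ : ℂ)).toAffineMap
      (meshPoint 1 a) (l.map (meshPoint 1)) t

/-- The curve of a walk at mesh `δ` is `δ` times its curve at mesh `1`. [folklore] -/
theorem toCurve_meshPoint_apply {G : SimpleGraph (Site 2)} {u v : Site 2} (w : G.Walk u v)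
    (δ : ℝ) (t : unitInterval) :
    w.toCurve (meshPoint δ) t = (δ : ℂ) * w.toCurve (meshPoint 1) t :=
  polyline_map_meshPoint δ w.support t

/-- The crux's loop function at mesh `δ` is `δ` times the one at mesh `1`. [folklore] -/
theorem iccExtend_toCurve_meshPoint {G : SimpleGraph (Site 2)} {u v : Site 2} (w : G.Walk u v)
    (δ : ℝ) (t : ℝ) :
    IccExtend zero_le_one (w.toCurve (meshPoint δ)) t =
      (δ : ℂ) * IccExtend zero_le_one (w.toCurve (meshPoint 1)) t :=
  toCurve_meshPoint_apply w δ _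

/-- The curve of a walk only depends on its support. [folklore] -/
theorem toCurve_eq_of_support_eq {G G' : SimpleGraph (Site 2)} {u v u' v' : Site 2}
    (w : G.Walk u v) (w' : G'.Walk u' v') (emb : Site 2 → ℂ) (h : w.support = w'.support) :
    w.toCurve emb = w'.toCurve emb := by
  unfold SimpleGraph.Walk.toCurve
  rw [h]

/-! ## Scaling of the winding number -/

/-- `wind (c · g) = wind g` for a complex constant `c ≠ 0` (junk cases included: `c · g` is a
loop with a logarithm on `[0, 1]` iff `g` is). [folklore] -/
theorem wind_const_mul {c : ℂ} (hc : c ≠ 0) (g : ℝ → ℂ) :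
    wind (fun t => c * g t) = wind g := by
  by_cases h : HasLogOn g (Icc 0 1) ∧ g 0 = g 1
  · obtain ⟨l, hl, hle⟩ := h.1
    have e1 := wind_spec hl hle h.2
    have e2 := wind_spec (f := fun t => c * g t) (l := fun t => log c + l t)
      (continuousOn_const.add hl) (fun t ht => by rw [exp_add, exp_log hc, hle t ht])
      (by simp only [h.2])
    apply int_eq_of_mul_two_pi_I_eq
    rw [← e1, ← e2]
    ring
  · have h' : ¬ (HasLogOn (fun t => c * g t) (Icc 0 1) ∧ c * g 0 = c * g 1) := by
      rintro ⟨h1, h2⟩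
      refine h ⟨?_, mul_left_cancel₀ hc h2⟩
      have h3 := (hasLogOn_const (inv_ne_zero hc) (Icc (0 : ℝ) 1)).mul h1
      exact h3.congr fun t _ => inv_mul_cancel_left₀ hc (g t)
    unfold wind
    rw [dif_neg h, dif_neg h']

/-- Rescaling a loop by `c ≠ 0` rescales the base point: `wind (c F - z) = wind (F - z / c)`.
[folklore] -/
theorem wind_const_mul_sub {c : ℂ} (hc : c ≠ 0) (F : ℝ → ℂ) (z : ℂ) :
    wind (fun t => c * F t - z) = wind (fun t => F t - z / c) := by
  rw [← wind_const_mul hc (fun t => F t - z / c)]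
  congr 1
  funext t
  rw [mul_sub, mul_div_cancel₀ z hc]

/-- Non-negativity of the winding number about EVERY point is scale invariant. [folklore] -/
theorem forall_wind_nonneg_iff {c : ℂ} (hc : c ≠ 0) (F : ℝ → ℂ) :
    (∀ z, 0 ≤ wind (fun t => c * F t - z)) ↔ ∀ z, 0 ≤ wind (fun t => F t - z) := by
  constructor
  · intro h z
    have hz := h (c * z)
    rwa [wind_const_mul_sub hc, mul_div_cancel_left₀ z hc] at hz
  · intro h z
    rw [wind_const_mul_sub hc]
    exact h (z / c)

/-! ## The discrete structures of `(dom C δ, δ)` and `(dom C 1, 1)` coincide -/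

section Structures

variable {c : Site 2} (C : (zdGraph 2).Walk c c) {δ : ℝ}

/-- `δ z ∈ dom C δ ↔ z ∈ dom C 1`. [folklore] -/
theorem mul_mem_dom_iff (hδ : δ ≠ 0) (z : ℂ) :
    (δ : ℂ) * z ∈ dom C δ ↔ z ∈ dom C 1 := by
  have hδ' : (δ : ℂ) ≠ 0 := ofReal_ne_zero.2 hδ
  simp only [dom, mem_setOf_eq]
  rw [show (fun t : ℝ => IccExtend zero_le_one (C.toCurve (meshPoint δ)) t - δ * z) =
      fun t => (δ : ℂ) * IccExtend zero_le_one (C.toCurve (meshPoint 1)) t - δ * z from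
    funext fun t => by rw [iccExtend_toCurve_meshPoint], wind_const_mul_sub hδ',
    mul_div_cancel_left₀ z hδ']

/-- `dom C δ` is the image of `dom C 1` under the homeomorphism `z ↦ δ z`. [folklore] -/
theorem dom_eq_image (hδ : δ ≠ 0) :
    dom C δ = Homeomorph.mulLeft₀ (δ : ℂ) (ofReal_ne_zero.2 hδ) '' dom C 1 := by
  have hδ' : (δ : ℂ) ≠ 0 := ofReal_ne_zero.2 hδ
  ext z
  simp only [Homeomorph.coe_mulLeft₀, mem_image]
  constructor
  · intro hz
    refine ⟨z / δ, (mul_mem_dom_iff C hδ _).1 ?_, mul_div_cancel₀ z hδ'⟩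
    rwa [mul_div_cancel₀ z hδ']
  · rintro ⟨w, hw, rfl⟩
    exact (mul_mem_dom_iff C hδ w).2 hw

/-- The mesh vertices coincide. [folklore] -/
theorem meshVertices_dom (hδ : δ ≠ 0) :
    meshVertices (dom C δ) δ = meshVertices (dom C 1) 1 := by
  ext x
  rw [mem_meshVertices_iff, mem_meshVertices_iff, meshPoint_eq_mul δ, mul_mem_dom_iff C hδ]

/-- Segments between rescaled points are rescaled segments. [folklore] -/
theorem segment_mul (r a b : ℂ) :
    segment ℝ (r * a) (r * b) = (fun z => r * z) '' segment ℝ a b :=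
  (image_segment ℝ (LinearMap.mulLeft ℝ r).toAffineMap a b).symm

/-- The mesh graphs coincide. [folklore] -/
theorem meshGraph_dom (hδ : δ ≠ 0) : meshGraph (dom C δ) δ = meshGraph (dom C 1) 1 := by
  have hδ' : (δ : ℂ) ≠ 0 := ofReal_ne_zero.2 hδ
  ext x y
  simp only [meshGraph_adj_iff]
  refine and_congr_right fun _ => ?_
  rw [dom_eq_image C hδ, ← Homeomorph.image_closure, meshPoint_eq_mul δ x,
    meshPoint_eq_mul δ y, segment_mul, ← Homeomorph.coe_mulLeft₀ (δ : ℂ) hδ',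
    image_subset_image_iff (Homeomorph.injective _)]

/-- `meshDomain` is a function of (`meshVertices`, `meshGraph`) only. [folklore] -/
theorem meshDomain_congr {Ω Ω' : Set ℂ} {δ δ' : ℝ}
    (hV : meshVertices Ω δ = meshVertices Ω' δ') (hG : meshGraph Ω δ = meshGraph Ω' δ') :
    meshDomain Ω δ = meshDomain Ω' δ' := by
  have key : ∀ (S S' : Set (Site 2)) (G G' : SimpleGraph (Site 2)), S = S' → G = G' →
      (⋃ (K : (G.induce S).ConnectedComponent)
          (_ : ∀ K' : (G.induce S).ConnectedComponent, K'.supp.ncard ≤ K.supp.ncard),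
          Subtype.val '' K.supp : Set (Site 2)) =
        ⋃ (K : (G'.induce S').ConnectedComponent)
          (_ : ∀ K' : (G'.induce S').ConnectedComponent, K'.supp.ncard ≤ K.supp.ncard),
          Subtype.val '' K.supp := by
    rintro S S' G G' rfl rfl
    rfl
  exact key _ _ _ _ hV hG

/-- The discrete domains coincide. [folklore] -/
theorem meshDomain_dom (hδ : δ ≠ 0) : meshDomain (dom C δ) δ = meshDomain (dom C 1) 1 :=
  meshDomain_congr (meshVertices_dom C hδ) (meshGraph_dom C hδ)

/-- The graphs `Ω_δ` coincide. [folklore] -/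
theorem discreteDomainGraph_dom (hδ : δ ≠ 0) :
    discreteDomainGraph (dom C δ) δ = discreteDomainGraph (dom C 1) 1 := by
  ext x y
  rw [discreteDomainGraph_adj_iff, discreteDomainGraph_adj_iff, meshGraph_dom C hδ,
    meshDomain_dom C hδ]

end Structures

/-! ## Transfer of chords along an equality of graphs -/

/-- Two chords with the same support are equal. [folklore] -/
theorem domainSAW_eq_of_support_eq {Ω : Set ℂ} {δ : ℝ} {a b : Site 2}
    {γ γ' : SAW.DomainSAW Ω δ a b} (h : γ.walk.support = γ'.walk.support) : γ = γ' := by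
  have hw : γ.walk = γ'.walk := SimpleGraph.Walk.ext_support h
  cases γ; cases γ'; cases hw; rfl

/-- Chords of two discretisations with the same graph `Ω_δ` are in a support-preserving
bijection (`SimpleGraph.Walk.transfer`). [folklore] -/
theorem exists_equiv_of_graph_eq {Ω Ω' : Set ℂ} {δ δ' : ℝ}
    (hG : discreteDomainGraph Ω δ = discreteDomainGraph Ω' δ') (a b : Site 2) :
    ∃ e : SAW.DomainSAW Ω δ a b ≃ SAW.DomainSAW Ω' δ' a b,
      ∀ γ, (e γ).walk.support = γ.walk.support := by
  have h1 : ∀ (w : (discreteDomainGraph Ω δ).Walk a b), ∀ e ∈ w.edges,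
      e ∈ (discreteDomainGraph Ω' δ').edgeSet :=
    fun w e he => hG ▸ w.edges_subset_edgeSet he
  have h2 : ∀ (w : (discreteDomainGraph Ω' δ').Walk a b), ∀ e ∈ w.edges,
      e ∈ (discreteDomainGraph Ω δ).edgeSet :=
    fun w e he => hG.symm ▸ w.edges_subset_edgeSet he
  refine ⟨{ toFun := fun γ => ⟨γ.walk.transfer _ (h1 γ.walk), γ.isPath.transfer _⟩
            invFun := fun γ => ⟨γ.walk.transfer _ (h2 γ.walk), γ.isPath.transfer _⟩
            left_inv := fun γ => domainSAW_eq_of_support_eq (by simp)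
            right_inv := fun γ => domainSAW_eq_of_support_eq (by simp) }, fun γ => ?_⟩
  exact SimpleGraph.Walk.support_transfer _ _

/-! ## The registered stub -/

/-- REGISTERED STUB `stub_meshReduction` (line `corner-localisation`): for `δ > 0` the chords of
`(C, δ)` and of `(C, 1)` are in a support-preserving bijection which preserves the left–right
order. [folklore] -/
theorem stub_meshReduction : MeshReduction := by
  intro δ c a b C hδ
  have hδ' : (δ : ℂ) ≠ 0 := ofReal_ne_zero.2 hδ.ne'
  obtain ⟨e, he⟩ := exists_equiv_of_graph_eq (discreteDomainGraph_dom C hδ.ne') a b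
  refine ⟨e, he, fun γ₁ γ₂ => ?_⟩
  have hsupp : ((e γ₁).walk.append (e γ₂).walk.reverse).support =
      (γ₁.walk.append γ₂.walk.reverse).support := by
    rw [SimpleGraph.Walk.support_append, SimpleGraph.Walk.support_append,
      SimpleGraph.Walk.support_reverse, SimpleGraph.Walk.support_reverse, he, he]
  unfold lr
  rw [toCurve_eq_of_support_eq _ _ (meshPoint 1) hsupp,
    ← forall_wind_nonneg_iff hδ' (fun t => IccExtend zero_le_one
      ((γ₁.walk.append γ₂.walk.reverse).toCurve (meshPoint 1)) t)]
  simp only [← iccExtend_toCurve_meshPoint]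

end Summit.CriticalPhenomena.SAWScalingLimit.Theorems.LeftRightFKG.CornerLoc

end
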